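import Literature.MathematicalPhysics.QuantumFieldTheory.Balaban1983to89.Node00.Record12LiveSelector
import Literature.MathematicalPhysics.QuantumFieldTheory.Balaban1983to89.B15FibreLemmaSupp
import Literature.MathematicalPhysics.QuantumFieldTheory.Balaban1983to89.B14Eq218SeqSucc

/-!
# NODE 00 — DEAD SEQUENCES CARRY NO MASS: a sequence that is not live (its identity-selector post-𝐑 slot vanishes everywhere) has fibre integral
# `∫⌈_{Z′} t ≡ 0` and hence `∫ t = 0`; so the LIVE selector preserves the prefix of every massive sequence

Cell `pub-ymgap`, YM-PLAN Track A (HUMAN RULING D-0062); author seat `pub-ymgap-dag-n20-d` (g37, the N20 lineage), on def-K0a's `Node00/Record12LiveSelector` (`LiveSeq`,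
`liveSelOfSlot`, `rstepOfSel_id_TexpA`), def-R's `rstepSlot ∕ sliceOfRecord ∕ fibOfSeq` and b01's fibre integral `B15BasicStep.fibreIntegral` (= `toReal ∘ lmarginal ∘ ofReal`).
[IV] = [Balaban1989LargeFieldI].

WHY.  The 𝐑-half of the class-wise telescoping law of the N20 lineage's tower sockets (`Node00/RStepFibreMass.sum_filter_integral_chi_mul_rstepSlot`) holds at every selector
that PRESERVES THE PREFIX of every sequence of non-zero mass (`(sel s).init = s.init ∨ ∫ t_s = 0`).  The identity qualifies trivially; this file proves that def-K0a's LIVE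
selector `liveSelOfSlot f` (director-ym №114 (α): the K0′ witness's pin) qualifies too: a live sequence is a fixed point (`liveSelOfSlot_of_live`), and a DEAD one — every value
of `f(s)(V)·∫⌈t_s(V)∕∫⌈t_s(V)` vanishes — has `∫⌈_{Z′(s)} t_s ≡ 0` (§1 ★ `fibreIntegral_eq_zero_of_dead`: if the fibre integral were non-zero at `V`, some point `U` of the
fibre of `V` would carry `t_s(U) > 0`, and there the own-ratio is `1`, contradicting deadness — [IV] p. 176 «the densities are positive, and the integration domains …
nonempty, hence the denominators are positive», read contrapositively) and therefore ZERO MASS (§1 ★ `integral_eq_zero_of_fibreIntegral_eq_zero`: fibre integrals determine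
total integrals, Mathlib `lintegral_eq_of_lmarginal_eq`).  §2: ★★ `liveSelOfSlot_init_eq_or_integral_eq_zero`.

WHAT IS PROVED (Mathlib `lmarginal` bookkeeping + b01's `fieldMeasure_eq_pi ∕ lmarginal_ofReal_le` + `B15FibreLemmaSupp.fibreIntegral_updateFinset`; TS-8 explicit `iP` binders).
* §1 (generic over `Setup`): ★ `fibreIntegral_eq_zero_of_dead` (fibre-constancy by `B15FibreLemmaSupp.fibreIntegral_updateFinset`), ★ `integral_eq_zero_of_fibreIntegral_eq_zero`.
* §2 (of record, `G = SU(N)`): ★ `integral_rterm_eq_zero_of_dead` (generic over `Step.Repr218 P (SU N) j`), ★★ `integral_chi_mul_eq_zero_of_not_live`,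
  ★★ `liveSelOfSlot_init_eq_or_integral_eq_zero` (bounded, non-negative, measurable term of the sequence).

HONEST FRAMING.  Nothing of Bałaban's is asserted; measurability ∕ non-negativity ∕ boundedness of the term are HYPOTHESES; no estimate; no `Provisos` inhabitant claimed;
whether the record's tuple at Stage 13 carries the live selector OF ITS OWN (dressed) slot family is NOT decided here.  Counts UNMOVED (typed 28∕28 · discharged 8∕27);
one finite four-torus programme at fixed `ε` — NOT ℝ⁴ ∕ OS ∕ mass gap ∕ Clay.  No `def`, no `sorry`, no `axiom`, no `instance`, no `notation`.
-/

noncomputable section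

open MeasureTheory Function
open scoped BigOperators ENNReal

namespace Literature.MathematicalPhysics.QuantumFieldTheory.Balaban1983to89.Node00

open T4Continuum B14.Eq218Concrete B15RopTotal
open B15.BasicStep (fibreIntegral fibreIntegral_updateFinset fieldMeasure_eq_pi lmarginal_ofReal_le ofReal_comp_measurable)

/-! ## §1 Generic: dead terms have vanishing fibre integrals, and vanishing fibre integrals mean zero mass -/

section Generic

variable {P : Params} {G : Type*} [GaugeGroup G] [MeasurableSpace G] [HaarData G] {j : ℕ}

/-- ★ **A DEAD TERM HAS VANISHING FIBRE INTEGRALS.**  If `f(V)·(∫⌈_{Z′} t (V) ∕ ∫⌈_{Z′} t (V)) = 0` for EVERY `V` (the identity-selector post-𝐑 slot vanishes everywhere —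
def-K0a's «not live»), where the term `t` is non-negative and vanishes wherever `f` does (`t = χ·f`), then `∫⌈_{Z′} t ≡ 0`: otherwise the fibre of a point with non-zero
fibre integral would contain a point `U` with `t(U) > 0`, hence `f(U) ≠ 0`, and there the own ratio is `1` (the fibre integral is constant along the fibre).  [IV] p. 176's
proviso «the densities are positive … hence the denominators are positive», read contrapositively. [cite: Balaban1989LargeFieldI, (0.3) p.176] -/
theorem fibreIntegral_eq_zero_of_dead (iP : DecidableEq (PBond P j)) (s : Finset (PBond P j)) {t f : Density P j G}
    (htf : ∀ V, t V ≠ 0 → f V ≠ 0) (hdead : ∀ V, f V * (fibreIntegral s t V / fibreIntegral s t V) = 0) (V : GaugeField P j G) :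
    fibreIntegral s t V = 0 := by
  by_contra hne
  -- the `ℝ≥0∞` fibre integral at `V` is non-zero
  have hlm : (∫⋯∫⁻_s, (fun U => ENNReal.ofReal (t U)) ∂(fun _ : PBond P j => (HaarData.haar : Measure G))) V ≠ 0 := by
    intro h
    apply hne
    unfold fibreIntegral
    rw [h, ENNReal.toReal_zero]
  -- hence the integrand is non-zero somewhere on the fibre of `V`
  have hex : ∃ y : ∀ b : s, G, ENNReal.ofReal (t (updateFinset V s y)) ≠ 0 := by
    by_contra hall
    apply hlm
    have hall' : ∀ y : ∀ b : s, G, ENNReal.ofReal (t (updateFinset V s y)) = 0 :=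
      fun y => not_not.mp ((not_exists.mp hall) y)
    simp only [lmarginal, hall', lintegral_zero]
  obtain ⟨y, hy⟩ := hex
  have htU : t (updateFinset V s y) ≠ 0 := fun h => hy (by rw [h, ENNReal.ofReal_zero])
  have hfU : f (updateFinset V s y) ≠ 0 := htf _ htU
  -- at that point the own ratio is `1`, contradicting deadness
  have hFU : fibreIntegral s t (updateFinset V s y) ≠ 0 := by
    rw [fibreIntegral_updateFinset s t V y]
    exact hne
  have := hdead (updateFinset V s y)
  rw [div_self hFU, mul_one] at this
  exact hfU this

/-- ★ **VANISHING FIBRE INTEGRALS MEAN ZERO MASS.**  A measurable, non-negative, bounded term whose fibre integral `∫⌈_{Z′} t` vanishes identically has `∫ t dV = 0`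
(fibre integrals determine total integrals over the product Haar measure: Mathlib `lintegral_eq_of_lmarginal_eq`; boundedness excludes the value `∞` behind a zero `toReal`).
[cite: Balaban1989LargeFieldI, (0.4) p.176] -/
theorem integral_eq_zero_of_fibreIntegral_eq_zero (iP : DecidableEq (PBond P j)) (s : Finset (PBond P j)) {t : Density P j G} (hm : Measurable t)
    (ht0 : ∀ V, 0 ≤ t V) {C : ℝ} (hC : ∀ V, t V ≤ C) (hFI : ∀ V, fibreIntegral s t V = 0) :
    ∫ V, t V ∂(fieldMeasure P j G) = 0 := by
  set μH : PBond P j → Measure G := fun _ => (HaarData.haar : Measure G) with hμH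
  have hlm0 : (∫⋯∫⁻_s, (fun U => ENNReal.ofReal (t U)) ∂μH) = ∫⋯∫⁻_s, (fun _ => (0 : ℝ≥0∞)) ∂μH := by
    funext V
    have htop : (∫⋯∫⁻_s, (fun U => ENNReal.ofReal (t U)) ∂μH) V ≠ ∞ :=
      ne_top_of_le_ne_top ENNReal.ofReal_ne_top (lmarginal_ofReal_le s hC V)
    have h := hFI V
    unfold fibreIntegral at h
    rw [← hμH, ENNReal.toReal_eq_zero_iff] at h
    rcases h with h | h
    · rw [h]
      simp [lmarginal]
    · exact absurd h htop
  have hlint : ∫⁻ V, ENNReal.ofReal (t V) ∂(fieldMeasure P j G) = 0 := by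
    rw [fieldMeasure_eq_pi]
    exact (lintegral_eq_of_lmarginal_eq s (ofReal_comp_measurable hm) measurable_const hlm0).trans lintegral_zero
  rw [integral_eq_lintegral_of_nonneg_ae (Filter.Eventually.of_forall ht0) hm.aestronglyMeasurable, hlint, ENNReal.toReal_zero]

end Generic

/-! ## §2 Of record (`G = SU(N)`): dead sequences carry no mass; the live selector preserves the prefix of every massive sequence -/

variable (F : T4Family) (N : ℕ) [NeZero N]

section OfRecord

variable {P : Params} {j : ℕ}

/-- ★ **A DEAD TERM OF A (2.18) REPRESENTATION CARRIES NO MASS** (generic over def-R's `Step.Repr218 P (SU N) j`): if the identity-selector R-stepped slot of `a` vanishes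
everywhere (`(rstepOfSel r id fib).TexpA a ≡ 0` — def-K0a's «not live», `rstepOfSel_id_TexpA`: the slot times its own normalisation ratio) and the term `t_a = χ(a)·(𝐓e^A)(a)`
is measurable, non-negative and bounded, then `∫ t_a = 0` (`fibreIntegral_eq_zero_of_dead` + `integral_eq_zero_of_fibreIntegral_eq_zero`).
[cite: Balaban1989LargeFieldI, (0.3)–(0.4) p.176] -/
theorem integral_rterm_eq_zero_of_dead (iP : DecidableEq (PBond P j)) (r : Step.Repr218 P (SU N) j) (fib : r.Adm → Finset (PBond P j)) (a : r.Adm)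
    (hm : Measurable (rterm r a)) (h0 : ∀ V, 0 ≤ rterm r a V) {C : ℝ} (hC : ∀ V, rterm r a V ≤ C)
    (hdead : ∀ V, (rstepOfSel r id fib).TexpA a V = 0) :
    ∫ V, rterm r a V ∂(fieldMeasure P j (SU N)) = 0 := by
  have hdead' : ∀ V, r.TexpA a V * (fibreIntegral (fib a) (rterm r a) V / fibreIntegral (fib a) (rterm r a) V) = 0 := by
    intro V
    have h := hdead V
    rw [rstepOfSel_id_TexpA N iP r fib a V] at h
    exact h
  have htf : ∀ V, rterm r a V ≠ 0 → r.TexpA a V ≠ 0 := by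
    intro V h hT
    apply h
    show r.χ a V * r.TexpA a V = 0
    rw [hT, mul_zero]
  exact integral_eq_zero_of_fibreIntegral_eq_zero iP (fib a) hm h0 hC (fibreIntegral_eq_zero_of_dead iP (fib a) htf hdead')

open scoped Classical in
/-- ★★ **A DEAD SEQUENCE OF RECORD CARRIES NO MASS**: at def-R's slot face, a sequence `s` of a level-`k` slot family `f` that is NOT live (def-K0a's `LiveSeq`: the
identity-selector post-𝐑 slot `rstepSlot … id f s` vanishes everywhere) and whose term `χ_k(s)·f(s)` is measurable, non-negative and bounded has `∫ χ_k(s)·f(s) = 0`.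
[cite: Balaban1989LargeFieldI, (0.3)–(0.4) p.176] -/
theorem integral_chi_mul_eq_zero_of_not_live (ν : Stage7Numerics) (τ : TowerNumerics) (p : B12.RunParams) (g : ℕ → ℝ) (k : ℕ)
    (f : TexpASlot F N ν τ.M p g k) (s : SeqOfRecord F ν τ.M g p.K k)
    (hm : Measurable (fun V => chiSeqOfRecord F N ν τ.M g p.K k s V * f s V))
    (h0 : ∀ V, 0 ≤ chiSeqOfRecord F N ν τ.M g p.K k s V * f s V) {C : ℝ}
    (hC : ∀ V, chiSeqOfRecord F N ν τ.M g p.K k s V * f s V ≤ C) (hs : ¬ LiveSeq F N ν τ p g k f s) :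
    ∫ V, chiSeqOfRecord F N ν τ.M g p.K k s V * f s V ∂(fieldMeasure (F.P p.K) k (SU N)) = 0 := by
  have hdead : ∀ V, rstepSlot F N ν τ p g k id f s V = 0 := fun V => by
    by_contra h
    exact hs ⟨V, h⟩
  unfold rstepSlot at hdead
  exact integral_rterm_eq_zero_of_dead N _ (sliceOfRecord F N ν τ.M p g k f) (fibOfSeq F ν τ p g k) s hm h0 hC hdead

open scoped Classical in
/-- ★★ **THE LIVE SELECTOR PRESERVES THE PREFIX OF EVERY MASSIVE SEQUENCE.**  For def-K0a's live selector of a level-`(k+1)` slot family `f` and any sequence `s` whose term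
`t_s = χ_{k+1}(s)·f(s)` is measurable, non-negative and bounded: either `s` is live — then it is a fixed point (`liveSelOfSlot_of_live`) and its prefix is kept — or it is dead
and carries NO MASS (`integral_chi_mul_eq_zero_of_not_live`).  This is the hypothesis `hsel` of `Node00/RStepFibreMass.sum_filter_integral_chi_mul_rstepSlot` at the live
selector. [cite: Balaban1989LargeFieldI, (0.3)–(0.4) p.176, p.177 (ii)] -/
theorem liveSelOfSlot_init_eq_or_integral_eq_zero (ν : Stage7Numerics) (τ : TowerNumerics) (p : B12.RunParams) (g : ℕ → ℝ) (k : ℕ)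
    (f : TexpASlot F N ν τ.M p g (k + 1)) (s : SeqOfRecord F ν τ.M g p.K (k + 1))
    (hm : Measurable (fun V => chiSeqOfRecord F N ν τ.M g p.K (k + 1) s V * f s V))
    (h0 : ∀ V, 0 ≤ chiSeqOfRecord F N ν τ.M g p.K (k + 1) s V * f s V) {C : ℝ}
    (hC : ∀ V, chiSeqOfRecord F N ν τ.M g p.K (k + 1) s V * f s V ≤ C) :
    (liveSelOfSlot F N ν τ p g (k + 1) f s).init = s.init ∨
      ∫ V, chiSeqOfRecord F N ν τ.M g p.K (k + 1) s V * f s V ∂(fieldMeasure (F.P p.K) (k + 1) (SU N)) = 0 := by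
  by_cases hs : LiveSeq F N ν τ p g (k + 1) f s
  · exact Or.inl (by rw [liveSelOfSlot_of_live F N hs])
  · exact Or.inr (integral_chi_mul_eq_zero_of_not_live F N ν τ p g (k + 1) f s hm h0 hC hs)

end OfRecord


/-! ## Erratum (v1.1, citation precision; ref-F READ-902 NIT-1, 2026-08-30)

In the docstrings above, «[IV] p. 177 (ii)» is cited next to «history-rewriting selector».  The printed (ii) on p. 177 of [Balaban1989LargeFieldI] is the COMPONENT-HISTORY
property of the class of components the ℝ-operation renormalises («(ii) in the preceding N renormalization steps no new large field regions were created inside this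
component, and the previous regions contained in it satisfy the condition (i) on the corresponding scales»), NOT a definition of the selector.  Reading the (0.3) selection
`Z ↦ Z″ = Z ∖ Z′` (p. 176), with `Z′` the union of the components satisfying (i)–(ii), as a «history-rewriting» map ON THE INDEX OF RECORD (one that changes the prefix of a
massive sequence) is this lineage's LOCATED-2 reading (cell bus, 2026-08-30), inferred from (0.3) p. 176 together with (i)–(ii) p. 177 — not a printed statement.  The
locator «p.177 (ii)» in the cite tags above should be read in that sense.  No declaration is affected. -/

end Literature.MathematicalPhysics.QuantumFieldTheory.Balaban1983to89.Node00

end
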